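import Literature.Barriers.AtomisticToContinuum.NoBVEstimatesMultiDFlowFamily
import HarnessLib

/-!
# Uniform-in-`δ` bounds for the family `W_δ` of regularised solutions: constants uniform in the
# datum, energy `≤ 1`, sup and `L²` control, and the `L²`-Cauchy bound

Brick B-ε, §2c, of the Kato existence programme for the symmetrizable branch of Rauch's Local
Existence Theorem (towards `Rauch1986_smallAmplitudeExpansionL2`). The energy, Grönwall and Cauchy
theorems of `NoBVEstimatesMultiDEnergyEstimate.lean`, `NoBVEstimatesMultiDUniformBound.lean` and
`NoBVEstimatesMultiDCauchy.lean` produce their constants for a FIXED datum; since the application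
lets the datum `u₀ = εφ` vary with `ε`, this file first restates them with the datum quantified
INSIDE the existential (`…_uniform`; the constructions never used the datum), then FIXES the
constants once and for all (`eRate`, `eConst`, `cConst`, `cRate`, by choice) and derives, for the
chosen flows `U_δ` and fields `W_δ(t) = ρ_δ ⋆ U_δ(t)` (`Wfam`, `NoBVEstimatesMultiDFlowFamily.lean`)
and under the smallness condition `eConst · e^{eRate·T} ℰ_m(u₀) < 1`
[Majda1984, Ch. 2, Thm 2.1 (2.16)], [TaylorPDEIII2011, Ch. 16, §1, (1.15)]:

* `energy_Wfam_le`, `energy_Wfam_le_one` — the energies stay `≤ eConst e^{eRate T} ℰ_m(u₀) ≤ 1`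
  on `[-T, T]`, for every `δ ∈ (0, 1]`;
* `norm_cwd_Wfam_le_Rdat` — **uniform sup bounds** `‖∂_c W_δ(t)(x)‖ ≤ R(u₀, T)` for
  `|c| + 2(d+1) ≤ m`, with `R(u₀,T) = (C_sob · eConst e^{eRate T} ℰ_m(u₀))^{1/2}` (small with the
  datum — the source of the `O(ε)` bounds of the limit);
* `l2norm_cwd_Wfam_le_one`, `memLp_cwd_Wfam`, `exists_bound_cwd_Wfam` — `L²` control;
* `l2norm_Wfam_sub_le` — **the `L²`-Cauchy bound** for the family, uniform on `[-T, T]`.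

Everything is proved; no named fact and no `sorry` is introduced.

## References

* [Majda1984] A. Majda, *Compressible Fluid Flow and Systems of Conservation Laws in Several
  Space Variables* (1984), Ch. 2, §2.1, Thm 2.1.
* [TaylorPDEIII2011] M. E. Taylor, *Partial Differential Equations III*, 2nd ed. (2011), Ch. 16,
  §1, (1.13)–(1.19).
-/

noncomputable section

open MeasureTheory Set Function Filter Metric ContinuousLinearMap
open scoped ContDiff Topology ENNReal NNReal Convolution RealInnerProductSpace

namespace Literature.Barriers.AtomisticToContinuum

open Literature.Analysis.PDE Literature.Analysis.FunctionSpaces Literature.Analysis.ODE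

variable {d k : ℕ}

variable {M L : ℝ} {a : Fin d → EuclideanSpace ℝ (Fin k) → (EuclideanSpace ℝ (Fin k) →L[ℝ] EuclideanSpace ℝ (Fin k))}
  {b : EuclideanSpace ℝ (Fin k) → EuclideanSpace ℝ (Fin k)}
  {s : EuclideanSpace ℝ (Fin k) → (EuclideanSpace ℝ (Fin k) →L[ℝ] EuclideanSpace ℝ (Fin k))}

/-! ### The three existence theorems with the datum quantified inside -/

/-- `exists_energy_deriv_bound`, uniformly in the datum. [cite: Majda1984, Ch. 2 §2.1, Thm 2.1, (2.15)] -/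
theorem exists_energy_deriv_bound_uniform (hS : IsSymmSmoothCoeff M L a b s) {m : ℕ}
    (hm : 4 * (d + 1) ≤ m) :
    ∃ C : ℝ, 0 ≤ C ∧ ∀ (u₀ : EuclideanSpace ℝ (Fin d) → EuclideanSpace ℝ (Fin k)) {δ : ℝ} (hδ : 0 < δ), δ ≤ 1 →
      ∀ (hu₀ : ContDiff ℝ ∞ u₀) (hu₀c : HasCompactSupport u₀)
        {U : ℝ → Lp (EuclideanSpace ℝ (Fin k)) 2 (volume : Measure (EuclideanSpace ℝ (Fin d)))}, U 0 = dataL2 hu₀ hu₀c →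
        (∀ t, HasDerivAt U (regField hS.toIsTameCoeff hδ (U t)) t) → ∀ t : ℝ,
        ∑ α ∈ wordsLE (Fin d) m, ‖dcurve hS.toIsTameCoeff hδ hu₀ hu₀c U α t‖ ^ 2 ≤ 1 →
        ∀ α : List (Fin d), α.length ≤ m →
          |⟪weightOpDeriv hS hδ (U t) (dcurve hS.toIsTameCoeff hδ hu₀ hu₀c U α t),
              dcurve hS.toIsTameCoeff hδ hu₀ hu₀c U α t⟫ +
            2 * ⟪weightOp hS hδ (U t) (derivedField hS.toIsTameCoeff hδ α (U t)),
              dcurve hS.toIsTameCoeff hδ hu₀ hu₀c U α t⟫| ≤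
          C * ∑ β ∈ wordsLE (Fin d) m, ‖dcurve hS.toIsTameCoeff hδ hu₀ hu₀c U β t‖ ^ 2 := by
  -- orders
  set q : ℕ := m - 2 * (d + 1) with hqdef
  have hq : 1 ≤ q := by omega
  have hmq : m ≤ 2 * q := by omega
  have hqm : q + 2 * (d + 1) ≤ m := by omega
  have hmq' : m ≤ 2 * q + 1 := by omega
  -- coefficient constants
  obtain ⟨K₀, -, hK₀⟩ := hS.exists_norm_s_le
  obtain ⟨K₁, hK₁0, hK₁⟩ := hS.exists_norm_fderiv_s_le
  set R₀ : ℝ := Real.sqrt (supConst (Fin d) (EuclideanSpace ℝ (Fin k))) with hR₀def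
  -- tame and sup constants
  have hTa0 := fun j : Fin d =>
    exists_tame_bound_cwd_comp_whole (ι := Fin d) m (hS.smooth_a j) (hS.bdd_a j) q hmq' R₀
  choose Ca hCa0 hCa using hTa0
  have hSa0 := fun j : Fin d =>
    exists_sup_bound_cwd_comp_whole (ι := Fin d) q (hS.smooth_a j) (hS.bdd_a j) R₀
  choose Ca' hCa'0 hCa' using hSa0
  obtain ⟨Cb, hCb0, hCb⟩ :=
    exists_tame_bound_cwd_comp_whole (ι := Fin d) m hS.smooth_b hS.bdd_b q hmq' R₀
  obtain ⟨Cs', hCs'0, hCs'⟩ := exists_sup_bound_cwd_comp_whole (ι := Fin d) q hS.smooth_s hS.bdd_s R₀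
  set CA : ℝ := ∑ j, Ca j with hCA
  set CA' : ℝ := ∑ j, Ca' j with hCA'
  have hCA0 : 0 ≤ CA := Finset.sum_nonneg fun j _ => hCa0 j
  have hCA'0 : 0 ≤ CA' := Finset.sum_nonneg fun j _ => hCa'0 j
  have hleA : ∀ j, Ca j ≤ CA := fun j =>
    Finset.single_le_sum (f := Ca) (fun i _ => hCa0 i) (Finset.mem_univ j)
  have hleA' : ∀ j, Ca' j ≤ CA' := fun j =>
    Finset.single_le_sum (f := Ca') (fun i _ => hCa'0 i) (Finset.mem_univ j)
  -- the uniform specs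
  have hTa : ∀ (j : Fin d) (h : (EuclideanSpace ℝ (Fin d)) → (EuclideanSpace ℝ (Fin k))), ContDiff ℝ ∞ h →
      (∀ c : List (Fin d), 1 ≤ c.length → c.length ≤ q → ∀ x, ‖cwd c h x‖ ≤ R₀) →
      ∀ Y : ℝ, 0 ≤ Y → (∀ c : List (Fin d), 1 ≤ c.length → c.length ≤ m →
        MemLp (cwd c h) 2 (volume : Measure (EuclideanSpace ℝ (Fin d))) ∧ l2norm (cwd c h) ≤ Y) →
      ∀ v : List (Fin d), 1 ≤ v.length → v.length ≤ m →
        MemLp (cwd v (fun y => a j (h y))) 2 (volume : Measure (EuclideanSpace ℝ (Fin d))) ∧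
          l2norm (cwd v (fun y => a j (h y))) ≤ CA * Y := by
    intro j h hh hsupc Y hY hL2c v hv1 hv
    obtain ⟨hm', hle'⟩ := hCa j h hh hsupc Y hY hL2c v hv1 hv
    exact ⟨hm', hle'.trans (mul_le_mul_of_nonneg_right (hleA j) hY)⟩
  have hSa : ∀ (j : Fin d) (h : (EuclideanSpace ℝ (Fin d)) → (EuclideanSpace ℝ (Fin k))), ContDiff ℝ ∞ h →
      (∀ c : List (Fin d), 1 ≤ c.length → c.length ≤ q → ∀ x, ‖cwd c h x‖ ≤ R₀) →
      ∀ v : List (Fin d), v.length ≤ q → ∀ x, ‖cwd v (fun y => a j (h y)) x‖ ≤ CA' :=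
    fun j h hh hsupc v hv x => (hCa' j h hh hsupc v hv x).trans (hleA' j)
  refine ⟨K₁ * ((d * M + L) * R₀) +
      2 * (d * ((K₀ * M + (Cs' * M + K₀ * CA')) / 2) +
        (d * 2 ^ m * (CA * R₀ + CA') + (Cb + L)) * K₀ +
        d * Cs' * (d * M * (∑ i : Fin d, mollDerivConst (Fin d) (bv i)) +
          (d * 2 ^ m * (CA * R₀ + CA') + (Cb + L)))), ?_, ?_⟩
  · have hK₀0 : 0 ≤ K₀ := (norm_nonneg _).trans (hK₀ 0)
    have hM0 : 0 ≤ M := hS.M_nonneg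
    have hL0 : 0 ≤ L := hS.L_nonneg
    have hR₀0 : 0 ≤ R₀ := Real.sqrt_nonneg _
    have hKD0 : 0 ≤ ∑ i : Fin d, mollDerivConst (Fin d) (bv i) :=
      Finset.sum_nonneg fun i _ => mollDerivConst_nonneg (bv i)
    positivity
  · intro u₀ δ hδ hδ1 hu₀ hu₀c U hU0 hU t hE α hα
    exact energy_term_bound_at hS hq hmq hqm hK₀ hK₁0 hK₁ le_rfl hCA0 hCA'0 hCb0 hCs'0 hTa hSa
      hCb hCs' hδ hδ1 hu₀ hu₀c hU0 hU t hE hα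

/-- `exists_uniform_energy_bound`, uniformly in the datum. [cite: Majda1984, Ch. 2 §2.1, Thm 2.1, (2.15)–(2.16)] -/
theorem exists_uniform_energy_bound_uniform (hS : IsSymmSmoothCoeff M L a b s) {m : ℕ}
    (hm : 4 * (d + 1) ≤ m) :
    ∃ γ K : ℝ, 0 ≤ γ ∧ 0 ≤ K ∧ ∀ (u₀ : EuclideanSpace ℝ (Fin d) → EuclideanSpace ℝ (Fin k)) {δ : ℝ} (hδ : 0 < δ), δ ≤ 1 →
      ∀ (hu₀ : ContDiff ℝ ∞ u₀) (hu₀c : HasCompactSupport u₀)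
        {U : ℝ → Lp (EuclideanSpace ℝ (Fin k)) 2 (volume : Measure (EuclideanSpace ℝ (Fin d)))},
        U 0 = dataL2 hu₀ hu₀c → (∀ t, HasDerivAt U (regField hS.toIsTameCoeff hδ (U t)) t) →
        ∀ T : ℝ, 0 ≤ T → K * Real.exp (γ * T) * wordEnergy m u₀ < 1 →
        ∀ t ∈ Icc (-T) T,
          ∑ α ∈ wordsLE (Fin d) m, ‖dcurve hS.toIsTameCoeff hδ hu₀ hu₀c U α t‖ ^ 2 ≤
            K * Real.exp (γ * |t|) * wordEnergy m u₀ := by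
  obtain ⟨c₀, hc₀, hcoer⟩ := hS.coercive
  obtain ⟨K₀, hK₀0, hK₀⟩ := hS.exists_norm_s_le
  obtain ⟨C, hC0, hC⟩ := exists_energy_deriv_bound_uniform hS hm
  set N : ℝ := ((wordsLE (Fin d) m).card : ℝ) with hN
  have hN0 : 0 ≤ N := Nat.cast_nonneg _
  refine ⟨N * C / c₀, K₀ / c₀, div_nonneg (mul_nonneg hN0 hC0) hc₀.le, div_nonneg hK₀0 hc₀.le, ?_⟩
  intro u₀ δ hδ hδ1 hu₀ hu₀c U hU0 hU T hT hsmall t ht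
  have hUc : Continuous U := continuous_iff_continuousAt.2 fun τ => (hU τ).continuousAt
  -- the two energies
  set e : ℝ → ℝ := fun τ => ∑ α ∈ wordsLE (Fin d) m, ‖dcurve hS.toIsTameCoeff hδ hu₀ hu₀c U α τ‖ ^ 2
    with he
  set w : ℝ → ℝ := fun τ => ∑ α ∈ wordsLE (Fin d) m,
    ⟪weightOp hS hδ (U τ) (dcurve hS.toIsTameCoeff hδ hu₀ hu₀c U α τ),
      dcurve hS.toIsTameCoeff hδ hu₀ hu₀c U α τ⟫ with hw
  set w' : ℝ → ℝ := fun τ => ∑ α ∈ wordsLE (Fin d) m,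
    (⟪weightOpDeriv hS hδ (U τ) (dcurve hS.toIsTameCoeff hδ hu₀ hu₀c U α τ),
        dcurve hS.toIsTameCoeff hδ hu₀ hu₀c U α τ⟫ +
      2 * ⟪weightOp hS hδ (U τ) (derivedField hS.toIsTameCoeff hδ α (U τ)),
        dcurve hS.toIsTameCoeff hδ hu₀ hu₀c U α τ⟫) with hw'
  have h1 : ∀ τ, c₀ * e τ ≤ w τ := fun τ => by
    simp only [he, hw, Finset.mul_sum]
    exact Finset.sum_le_sum fun α _ => inner_weightOp_self_ge hS hδ hcoer (U τ) _
  have h2 : ∀ τ, w τ ≤ K₀ * e τ := fun τ => by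
    simp only [he, hw, Finset.mul_sum]
    exact Finset.sum_le_sum fun α _ => inner_weightOp_self_le hS hδ hK₀ (U τ) _
  have hecont : Continuous e := continuous_energy hS.toIsTameCoeff hδ hu₀ hu₀c hUc m
  have he0 : ∀ τ, 0 ≤ e τ := fun τ => Finset.sum_nonneg fun _ _ => sq_nonneg _
  have hwd : ∀ τ, HasDerivAt w (w' τ) τ := fun τ => by
    simp only [hw, hw']
    exact HasDerivAt.fun_sum fun α _ => hasDerivAt_weightedTerm hS hδ hu₀ hu₀c hU α τ
  have h5 : ∀ τ, e τ ≤ 1 → |w' τ| ≤ N * C * e τ := by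
    intro τ hτ
    simp only [hw']
    refine (Finset.abs_sum_le_sum_abs _ _).trans ?_
    calc ∑ α ∈ wordsLE (Fin d) m,
          |⟪weightOpDeriv hS hδ (U τ) (dcurve hS.toIsTameCoeff hδ hu₀ hu₀c U α τ),
              dcurve hS.toIsTameCoeff hδ hu₀ hu₀c U α τ⟫ +
            2 * ⟪weightOp hS hδ (U τ) (derivedField hS.toIsTameCoeff hδ α (U τ)),
              dcurve hS.toIsTameCoeff hδ hu₀ hu₀c U α τ⟫|
        ≤ ∑ _α ∈ wordsLE (Fin d) m, C * e τ :=
          Finset.sum_le_sum fun α hα => hC u₀ hδ hδ1 hu₀ hu₀c hU0 hU τ hτ α (mem_wordsLE.1 hα)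
      _ = N * C * e τ := by rw [Finset.sum_const, nsmul_eq_mul, hN]; ring
  have h6 : K₀ / c₀ * Real.exp (N * C / c₀ * T) * e 0 < 1 := by
    have h0 : e 0 = wordEnergy m u₀ := energy_zero_eq_wordEnergy hS.toIsTameCoeff hδ hu₀ hu₀c U m
    rw [h0]
    exact hsmall
  have hres := bootstrap_two_sided hc₀ hK₀0 (mul_nonneg hN0 hC0) hT h1 h2 hecont he0 hwd h5 h6 t ht
  have h0 : e 0 = wordEnergy m u₀ := energy_zero_eq_wordEnergy hS.toIsTameCoeff hδ hu₀ hu₀c U m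
  rw [h0] at hres
  exact hres

set_option maxHeartbeats 400000 in
/-- `exists_cauchy_bound`, uniformly in the datum. [cite: Majda1984, Ch. 2 §2.1, Thm 2.1 (proof, Step 2)] -/
theorem exists_cauchy_bound_uniform (hS : IsSymmSmoothCoeff M L a b s) {m : ℕ} (hm : 4 * (d + 1) ≤ m) :
    ∃ C γ : ℝ, 0 ≤ C ∧ 0 ≤ γ ∧ ∀ (u₀ : EuclideanSpace ℝ (Fin d) → EuclideanSpace ℝ (Fin k))
      {δ₁ δ₂ : ℝ} (hδ₁ : 0 < δ₁) (hδ₂ : 0 < δ₂)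
      (hu₀ : ContDiff ℝ ∞ u₀) (hu₀c : HasCompactSupport u₀)
      {U₁ U₂ : ℝ → Lp (EuclideanSpace ℝ (Fin k)) 2 (volume : Measure (EuclideanSpace ℝ (Fin d)))},
      U₁ 0 = dataL2 hu₀ hu₀c → U₂ 0 = dataL2 hu₀ hu₀c →
      (∀ t, HasDerivAt U₁ (regField hS.toIsTameCoeff hδ₁ (U₁ t)) t) →
      (∀ t, HasDerivAt U₂ (regField hS.toIsTameCoeff hδ₂ (U₂ t)) t) →
      ∀ T : ℝ,
      (∀ t ∈ Icc (-T) T, ∑ α ∈ wordsLE (Fin d) m, ‖dcurve hS.toIsTameCoeff hδ₁ hu₀ hu₀c U₁ α t‖ ^ 2 ≤ 1) →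
      (∀ t ∈ Icc (-T) T, ∑ α ∈ wordsLE (Fin d) m, ‖dcurve hS.toIsTameCoeff hδ₂ hu₀ hu₀c U₂ α t‖ ^ 2 ≤ 1) →
      ∀ t ∈ Icc (-T) T,
        l2norm (fun x => smoothRep (moll (Fin d) hδ₁) (U₁ t) x - smoothRep (moll (Fin d) hδ₂) (U₂ t) x) ≤
          C * Real.exp (γ * |t|) * (δ₁ + δ₂) * (1 + ∑ j, l2norm (cwd [j] u₀)) := by
  -- orders
  set q : ℕ := m - 2 * (d + 1) with hqdef
  have hq : 1 ≤ q := by omega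
  have hmq : m ≤ 2 * q := by omega
  have hqm : q + 2 * (d + 1) ≤ m := by omega
  have hm2 : 2 ≤ m := by omega
  have hmq' : m - 1 ≤ 2 * q + 1 := by omega
  -- coefficient constants
  obtain ⟨c₀, hc₀, hcoer⟩ := hS.coercive
  obtain ⟨K₀, hK₀0, hK₀⟩ := hS.exists_norm_s_le
  obtain ⟨K₁, hK₁0, hK₁⟩ := hS.exists_norm_fderiv_s_le
  set R₀ : ℝ := Real.sqrt (supConst (Fin d) (EuclideanSpace ℝ (Fin k))) with hR₀def
  have hTa0 := fun j : Fin d =>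
    exists_tame_bound_cwd_comp_whole (ι := Fin d) (m - 1) (hS.smooth_a j) (hS.bdd_a j) q hmq' R₀
  choose Ca hCa0 hCa using hTa0
  have hSa0 := fun j : Fin d =>
    exists_sup_bound_cwd_comp_whole (ι := Fin d) q (hS.smooth_a j) (hS.bdd_a j) R₀
  choose Ca' hCa'0 hCa' using hSa0
  obtain ⟨Cb, hCb0, hCb⟩ :=
    exists_tame_bound_cwd_comp_whole (ι := Fin d) (m - 1) hS.smooth_b hS.bdd_b q hmq' R₀
  obtain ⟨Cs', hCs'0, hCs'⟩ := exists_sup_bound_cwd_comp_whole (ι := Fin d) q hS.smooth_s hS.bdd_s R₀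
  set CA : ℝ := ∑ j, Ca j with hCA
  set CA' : ℝ := ∑ j, Ca' j with hCA'
  have hCA0 : 0 ≤ CA := Finset.sum_nonneg fun j _ => hCa0 j
  have hCA'0 : 0 ≤ CA' := Finset.sum_nonneg fun j _ => hCa'0 j
  have hleA : ∀ j, Ca j ≤ CA := fun j =>
    Finset.single_le_sum (f := Ca) (fun i _ => hCa0 i) (Finset.mem_univ j)
  have hleA' : ∀ j, Ca' j ≤ CA' := fun j =>
    Finset.single_le_sum (f := Ca') (fun i _ => hCa'0 i) (Finset.mem_univ j)
  have hTa : ∀ (j : Fin d) (h : EuclideanSpace ℝ (Fin d) → EuclideanSpace ℝ (Fin k)), ContDiff ℝ ∞ h →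
      (∀ c : List (Fin d), 1 ≤ c.length → c.length ≤ q → ∀ x, ‖cwd c h x‖ ≤ R₀) →
      ∀ Y : ℝ, 0 ≤ Y → (∀ c : List (Fin d), 1 ≤ c.length → c.length ≤ m - 1 →
        MemLp (cwd c h) 2 (volume : Measure (EuclideanSpace ℝ (Fin d))) ∧ l2norm (cwd c h) ≤ Y) →
      ∀ v : List (Fin d), 1 ≤ v.length → v.length ≤ m - 1 →
        MemLp (cwd v (fun y => a j (h y))) 2 (volume : Measure (EuclideanSpace ℝ (Fin d))) ∧
          l2norm (cwd v (fun y => a j (h y))) ≤ CA * Y := by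
    intro j h hh hsupc Y hY hL2c v hv1 hv
    obtain ⟨hm', hle'⟩ := hCa j h hh hsupc Y hY hL2c v hv1 hv
    exact ⟨hm', hle'.trans (mul_le_mul_of_nonneg_right (hleA j) hY)⟩
  have hSa : ∀ (j : Fin d) (h : EuclideanSpace ℝ (Fin d) → EuclideanSpace ℝ (Fin k)), ContDiff ℝ ∞ h →
      (∀ c : List (Fin d), 1 ≤ c.length → c.length ≤ q → ∀ x, ‖cwd c h x‖ ≤ R₀) →
      ∀ v : List (Fin d), v.length ≤ q → ∀ x, ‖cwd v (fun y => a j (h y)) x‖ ≤ CA' :=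
    fun j h hh hsupc v hv x => (hCa' j h hh hsupc v hv x).trans (hleA' j)
  -- the Grönwall rate and the final constant
  obtain ⟨Γ, hΓ⟩ : ∃ x : ℝ, x = (K₁ * ((d * M + L) * R₀) +
      2 * (d * ((K₀ * M + (Cs' * M + K₀ * CA')) / 2) + (d * M * R₀ + L) * K₀) +
      2 * (d * (d * M * 1 + (d * 2 ^ (m - 1) * (CA * R₀ + CA') + (Cb + L)))) * K₀) / c₀ +
      2 * (d * (d * M * 1 + (d * 2 ^ (m - 1) * (CA * R₀ + CA') + (Cb + L)))) * K₀ := ⟨_, rfl⟩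
  have hM0 : 0 ≤ M := hS.M_nonneg
  have hL0 : 0 ≤ L := hS.L_nonneg
  have hR₀0 : 0 ≤ R₀ := Real.sqrt_nonneg _
  have hd0 : (0 : ℝ) ≤ d := Nat.cast_nonneg d
  have hΓ0 : 0 ≤ Γ := by rw [hΓ]; positivity
  refine ⟨Real.sqrt ((K₀ + 1) / c₀), Γ, Real.sqrt_nonneg _, hΓ0, ?_⟩
  intro u₀ δ₁ δ₂ hδ₁ hδ₂ hu₀ hu₀c U₁ U₂ hU₁0 hU₂0 hU₁ hU₂ T hE₁ hE₂ t ht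
  -- the difference curve and its energy
  set Ω : ℝ → Lp (EuclideanSpace ℝ (Fin k)) 2 (volume : Measure (EuclideanSpace ℝ (Fin d))) :=
    fun τ => mollL2 hδ₁ (U₁ τ) - mollL2 hδ₂ (U₂ τ) with hΩdef
  set Φ : ℝ → ℝ := fun τ => ⟪weightOp hS hδ₁ (U₁ τ) (Ω τ), Ω τ⟫ + (δ₁ + δ₂) ^ 2 with hΦdef
  set Φ' : ℝ → ℝ := fun τ => ⟪weightOpDeriv hS hδ₁ (U₁ τ) (Ω τ), Ω τ⟫ +
    2 * ⟪weightOp hS hδ₁ (U₁ τ) (mollL2 hδ₁ (regField hS.toIsTameCoeff hδ₁ (U₁ τ)) -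
      mollL2 hδ₂ (regField hS.toIsTameCoeff hδ₂ (U₂ τ))), Ω τ⟫ with hΦ'def
  have hΩd : ∀ τ, HasDerivAt Ω (mollL2 hδ₁ (regField hS.toIsTameCoeff hδ₁ (U₁ τ)) -
      mollL2 hδ₂ (regField hS.toIsTameCoeff hδ₂ (U₂ τ))) τ := fun τ =>
    ((mollL2 hδ₁ : Lp (EuclideanSpace ℝ (Fin k)) 2 (volume : Measure (EuclideanSpace ℝ (Fin d))) →L[ℝ]
        _).hasFDerivAt.comp_hasDerivAt τ (hU₁ τ)).sub
      ((mollL2 hδ₂ : Lp (EuclideanSpace ℝ (Fin k)) 2 (volume : Measure (EuclideanSpace ℝ (Fin d))) →L[ℝ]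
        _).hasFDerivAt.comp_hasDerivAt τ (hU₂ τ))
  have hΦd : ∀ τ, HasDerivAt Φ (Φ' τ) τ := fun τ => by
    have h := (hasDerivAt_weighted_pair hS hδ₁ hU₁ (hΩd τ)).add_const ((δ₁ + δ₂) ^ 2)
    exact h
  have hΦ0 : ∀ τ, 0 ≤ Φ τ := fun τ =>
    add_nonneg (le_trans (mul_nonneg hc₀.le (sq_nonneg _)) (inner_weightOp_self_ge hS hδ₁ hcoer (U₁ τ) (Ω τ)))
      (sq_nonneg _)
  have hbd : ∀ τ ∈ Icc (-T) T, |Φ' τ| ≤ Γ * Φ τ := by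
    intro τ hτ
    have h := cauchy_deriv_bound_at hS hq hmq hqm hm2 hK₀ hK₁0 hK₁ le_rfl hCA0 hCA'0 hCb0 hCs'0 hc₀ hcoer
      hTa hSa hCb hCs' hδ₁ hδ₂ hu₀ hu₀c hU₁0 hU₂0 hU₁ hU₂ τ (hE₁ τ hτ) (hE₂ τ hτ) (Ω := Ω τ) rfl rfl
    rw [← hΓ] at h
    exact h
  have hG := gronwall_two_sided hΦ0 hΦd hbd t ht
  -- the initial value
  obtain ⟨D₀, hD₀⟩ : ∃ x : ℝ, x = ∑ j, l2norm (cwd [j] u₀) := ⟨_, rfl⟩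
  have hD₀0 : 0 ≤ D₀ := by rw [hD₀]; exact Finset.sum_nonneg fun j _ => l2norm_nonneg _
  have hΩ0 : ‖Ω 0‖ ≤ (δ₁ + δ₂) * D₀ := by
    have h := norm_mollL2_dataL2_sub_le (k := k) hδ₁ hδ₂ hu₀ hu₀c
    have e : Ω 0 = mollL2 hδ₁ (dataL2 hu₀ hu₀c) - mollL2 hδ₂ (dataL2 hu₀ hu₀c) := by
      simp only [hΩdef, hU₁0, hU₂0]
    rw [e, hD₀]
    exact h
  have hΦinit : Φ 0 ≤ (K₀ + 1) * (1 + D₀) ^ 2 * (δ₁ + δ₂) ^ 2 := by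
    have h1 : ⟪weightOp hS hδ₁ (U₁ 0) (Ω 0), Ω 0⟫ ≤ K₀ * ‖Ω 0‖ ^ 2 :=
      inner_weightOp_self_le hS hδ₁ hK₀ (U₁ 0) (Ω 0)
    have h2 : ‖Ω 0‖ ^ 2 ≤ ((δ₁ + δ₂) * D₀) ^ 2 := pow_le_pow_left₀ (norm_nonneg _) hΩ0 2
    have h3 : ⟪weightOp hS hδ₁ (U₁ 0) (Ω 0), Ω 0⟫ ≤ K₀ * ((δ₁ + δ₂) * D₀) ^ 2 :=
      h1.trans (mul_le_mul_of_nonneg_left h2 hK₀0)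
    have h4 : K₀ * D₀ ^ 2 + 1 ≤ (K₀ + 1) * (1 + D₀) ^ 2 := by nlinarith
    have h5 : (K₀ * D₀ ^ 2 + 1) * (δ₁ + δ₂) ^ 2 ≤ (K₀ + 1) * (1 + D₀) ^ 2 * (δ₁ + δ₂) ^ 2 :=
      mul_le_mul_of_nonneg_right h4 (sq_nonneg _)
    change ⟪weightOp hS hδ₁ (U₁ 0) (Ω 0), Ω 0⟫ + (δ₁ + δ₂) ^ 2 ≤ _
    have e : K₀ * ((δ₁ + δ₂) * D₀) ^ 2 + (δ₁ + δ₂) ^ 2 = (K₀ * D₀ ^ 2 + 1) * (δ₁ + δ₂) ^ 2 := by ring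
    linarith
  -- from the energy to the norm
  have hΩsq : ‖Ω t‖ ^ 2 ≤ Φ t / c₀ := by
    rw [le_div_iff₀ hc₀, mul_comm]
    change c₀ * ‖Ω t‖ ^ 2 ≤ ⟪weightOp hS hδ₁ (U₁ t) (Ω t), Ω t⟫ + (δ₁ + δ₂) ^ 2
    exact (inner_weightOp_self_ge hS hδ₁ hcoer (U₁ t) (Ω t)).trans (le_add_of_nonneg_right (sq_nonneg _))
  have hexp : Real.exp (Γ * |t|) ≤ Real.exp (Γ * |t|) ^ 2 := by
    have h1 : 1 ≤ Real.exp (Γ * |t|) := Real.one_le_exp (mul_nonneg hΓ0 (abs_nonneg t))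
    nlinarith
  set B : ℝ := Real.sqrt ((K₀ + 1) / c₀) * Real.exp (Γ * |t|) * (δ₁ + δ₂) * (1 + D₀) with hB
  have hB0 : 0 ≤ B := by positivity
  have hBsq : B ^ 2 = (K₀ + 1) / c₀ * Real.exp (Γ * |t|) ^ 2 * (δ₁ + δ₂) ^ 2 * (1 + D₀) ^ 2 := by
    rw [hB, mul_pow, mul_pow, mul_pow, Real.sq_sqrt (div_nonneg (by positivity) hc₀.le)]
  have hsq : ‖Ω t‖ ^ 2 ≤ B ^ 2 := by
    rw [hBsq]
    calc ‖Ω t‖ ^ 2 ≤ Φ t / c₀ := hΩsq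
      _ ≤ Real.exp (Γ * |t|) * Φ 0 / c₀ := div_le_div_of_nonneg_right hG hc₀.le
      _ ≤ Real.exp (Γ * |t|) ^ 2 * ((K₀ + 1) * (1 + D₀) ^ 2 * (δ₁ + δ₂) ^ 2) / c₀ := by
          refine div_le_div_of_nonneg_right ?_ hc₀.le
          exact mul_le_mul hexp hΦinit (hΦ0 0) (sq_nonneg _)
      _ = (K₀ + 1) / c₀ * Real.exp (Γ * |t|) ^ 2 * (δ₁ + δ₂) ^ 2 * (1 + D₀) ^ 2 := by
          field_simp
  have hfin : ‖Ω t‖ ≤ B := by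
    have h := Real.sqrt_le_sqrt hsq
    rwa [Real.sqrt_sq (norm_nonneg _), Real.sqrt_sq hB0] at h
  -- the representative
  have hΩn : ‖Ω t‖ = l2norm (fun x => smoothRep (moll (Fin d) hδ₁) (U₁ t) x -
      smoothRep (moll (Fin d) hδ₂) (U₂ t) x) := by
    rw [Lp.norm_def, l2norm_def, eLpNorm_congr_ae (coeFn_mollL2_sub hδ₁ hδ₂ (U₁ t) (U₂ t))]
  rw [← hΩn, ← hD₀]
  exact hfin

/-! ### The constants, fixed once and for all -/

section Consts

variable (hS : IsSymmSmoothCoeff M L a b s) {m : ℕ} (hm : 4 * (d + 1) ≤ m)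

/-- The Grönwall rate `γ` of the uniform energy bound. [cite: Majda1984, Ch. 2 §2.1, (2.16)] -/
def eRate : ℝ := Classical.choose (exists_uniform_energy_bound_uniform hS hm)

/-- The constant `K` of the uniform energy bound. [cite: Majda1984, Ch. 2 §2.1, (2.16)] -/
def eConst : ℝ := Classical.choose (Classical.choose_spec (exists_uniform_energy_bound_uniform hS hm))

/-- `0 ≤ γ`. [folklore] -/
theorem eRate_nonneg : 0 ≤ eRate hS hm :=
  (Classical.choose_spec (Classical.choose_spec (exists_uniform_energy_bound_uniform hS hm))).1

/-- `0 ≤ K`. [folklore] -/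
theorem eConst_nonneg : 0 ≤ eConst hS hm :=
  (Classical.choose_spec (Classical.choose_spec (exists_uniform_energy_bound_uniform hS hm))).2.1

/-- **The uniform energy bound with the fixed constants.** [cite: Majda1984, Ch. 2 §2.1, (2.16)] -/
theorem energy_le_of_small (u₀ : EuclideanSpace ℝ (Fin d) → EuclideanSpace ℝ (Fin k)) {δ : ℝ}
    (hδ : 0 < δ) (hδ1 : δ ≤ 1) (hu₀ : ContDiff ℝ ∞ u₀) (hu₀c : HasCompactSupport u₀)
    {U : ℝ → Lp (EuclideanSpace ℝ (Fin k)) 2 (volume : Measure (EuclideanSpace ℝ (Fin d)))}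
    (hU0 : U 0 = dataL2 hu₀ hu₀c) (hU : ∀ t, HasDerivAt U (regField hS.toIsTameCoeff hδ (U t)) t)
    {T : ℝ} (hT : 0 ≤ T) (hsmall : eConst hS hm * Real.exp (eRate hS hm * T) * wordEnergy m u₀ < 1)
    {t : ℝ} (ht : t ∈ Icc (-T) T) :
    ∑ α ∈ wordsLE (Fin d) m, ‖dcurve hS.toIsTameCoeff hδ hu₀ hu₀c U α t‖ ^ 2 ≤
      eConst hS hm * Real.exp (eRate hS hm * |t|) * wordEnergy m u₀ :=
  (Classical.choose_spec (Classical.choose_spec (exists_uniform_energy_bound_uniform hS hm))).2.2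
    u₀ hδ hδ1 hu₀ hu₀c hU0 hU T hT hsmall t ht

/-- The constant `C` of the `L²`-Cauchy bound. [cite: Majda1984, Ch. 2 §2.1, Thm 2.1 (proof, Step 2)] -/
def cConst : ℝ := Classical.choose (exists_cauchy_bound_uniform hS hm)

/-- The rate `γ` of the `L²`-Cauchy bound. [cite: Majda1984, Ch. 2 §2.1, Thm 2.1 (proof, Step 2)] -/
def cRate : ℝ := Classical.choose (Classical.choose_spec (exists_cauchy_bound_uniform hS hm))

/-- `0 ≤ C`. [folklore] -/
theorem cConst_nonneg : 0 ≤ cConst hS hm :=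
  (Classical.choose_spec (Classical.choose_spec (exists_cauchy_bound_uniform hS hm))).1

/-- `0 ≤ γ`. [folklore] -/
theorem cRate_nonneg : 0 ≤ cRate hS hm :=
  (Classical.choose_spec (Classical.choose_spec (exists_cauchy_bound_uniform hS hm))).2.1

/-- **The `L²`-Cauchy bound with the fixed constants.** [cite: Majda1984, Ch. 2 §2.1, Thm 2.1 (proof, Step 2)] -/
theorem cauchy_of_energy_le_one (u₀ : EuclideanSpace ℝ (Fin d) → EuclideanSpace ℝ (Fin k))
    {δ₁ δ₂ : ℝ} (hδ₁ : 0 < δ₁) (hδ₂ : 0 < δ₂) (hu₀ : ContDiff ℝ ∞ u₀) (hu₀c : HasCompactSupport u₀)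
    {U₁ U₂ : ℝ → Lp (EuclideanSpace ℝ (Fin k)) 2 (volume : Measure (EuclideanSpace ℝ (Fin d)))}
    (hU₁0 : U₁ 0 = dataL2 hu₀ hu₀c) (hU₂0 : U₂ 0 = dataL2 hu₀ hu₀c)
    (hU₁ : ∀ t, HasDerivAt U₁ (regField hS.toIsTameCoeff hδ₁ (U₁ t)) t)
    (hU₂ : ∀ t, HasDerivAt U₂ (regField hS.toIsTameCoeff hδ₂ (U₂ t)) t) (T : ℝ)
    (hE₁ : ∀ t ∈ Icc (-T) T, ∑ α ∈ wordsLE (Fin d) m, ‖dcurve hS.toIsTameCoeff hδ₁ hu₀ hu₀c U₁ α t‖ ^ 2 ≤ 1)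
    (hE₂ : ∀ t ∈ Icc (-T) T, ∑ α ∈ wordsLE (Fin d) m, ‖dcurve hS.toIsTameCoeff hδ₂ hu₀ hu₀c U₂ α t‖ ^ 2 ≤ 1)
    {t : ℝ} (ht : t ∈ Icc (-T) T) :
    l2norm (fun x => smoothRep (moll (Fin d) hδ₁) (U₁ t) x - smoothRep (moll (Fin d) hδ₂) (U₂ t) x) ≤
      cConst hS hm * Real.exp (cRate hS hm * |t|) * (δ₁ + δ₂) * (1 + ∑ j, l2norm (cwd [j] u₀)) :=
  (Classical.choose_spec (Classical.choose_spec (exists_cauchy_bound_uniform hS hm))).2.2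
    u₀ hδ₁ hδ₂ hu₀ hu₀c hU₁0 hU₂0 hU₁ hU₂ T hE₁ hE₂ t ht

end Consts

/-! ### Bounds for the family `W_δ` under the smallness condition -/

section Family

variable (hS : IsSymmSmoothCoeff M L a b s) {m : ℕ} (hm : 4 * (d + 1) ≤ m)
  {u₀ : EuclideanSpace ℝ (Fin d) → EuclideanSpace ℝ (Fin k)} (hu₀ : ContDiff ℝ ∞ u₀)
  (hu₀c : HasCompactSupport u₀) {T : ℝ} (hT : 0 ≤ T)
  (hsm : eConst hS hm * Real.exp (eRate hS hm * T) * wordEnergy m u₀ < 1)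

include hT hsm in
/-- **The energies of the family stay below `eConst e^{eRate T} ℰ_m(u₀)`** on `[-T, T]`.
[cite: Majda1984, Ch. 2 §2.1, (2.16)] -/
theorem energy_Wfam_le {δ : ℝ} (hδ : 0 < δ) (hδ1 : δ ≤ 1) {t : ℝ} (ht : t ∈ Icc (-T) T) :
    ∑ α ∈ wordsLE (Fin d) m,
      ‖dcurve hS.toIsTameCoeff hδ hu₀ hu₀c (flow hS.toIsTameCoeff hδ hu₀ hu₀c) α t‖ ^ 2 ≤
      eConst hS hm * Real.exp (eRate hS hm * T) * wordEnergy m u₀ := by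
  refine (energy_le_of_small hS hm u₀ hδ hδ1 hu₀ hu₀c (flow_zero _ hδ hu₀ hu₀c)
    (hasDerivAt_flow _ hδ hu₀ hu₀c) hT hsm ht).trans ?_
  have habs : |t| ≤ T := abs_le.2 ⟨by linarith [ht.1], ht.2⟩
  have hexp : Real.exp (eRate hS hm * |t|) ≤ Real.exp (eRate hS hm * T) :=
    Real.exp_le_exp.2 (mul_le_mul_of_nonneg_left habs (eRate_nonneg hS hm))
  exact mul_le_mul_of_nonneg_right (mul_le_mul_of_nonneg_left hexp (eConst_nonneg hS hm))
    (wordEnergy_nonneg _ _)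

include hT hsm in
/-- **The energies of the family stay `≤ 1`** on `[-T, T]`. [cite: Majda1984, Ch. 2 §2.1, (2.16)] -/
theorem energy_Wfam_le_one {δ : ℝ} (hδ : 0 < δ) (hδ1 : δ ≤ 1) {t : ℝ} (ht : t ∈ Icc (-T) T) :
    ∑ α ∈ wordsLE (Fin d) m,
      ‖dcurve hS.toIsTameCoeff hδ hu₀ hu₀c (flow hS.toIsTameCoeff hδ hu₀ hu₀c) α t‖ ^ 2 ≤ 1 :=
  (energy_Wfam_le hS hm hu₀ hu₀c hT hsm hδ hδ1 ht).trans hsm.le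

/-- **The sup radius of the family**: `R(u₀, T) = (C_sob · eConst e^{eRate T} ℰ_m(u₀))^{1/2}`.
[cite: Majda1984, Ch. 2 §2.1] -/
def Rdat (hS : IsSymmSmoothCoeff M L a b s) {m : ℕ} (hm : 4 * (d + 1) ≤ m) (T : ℝ)
    (u₀ : EuclideanSpace ℝ (Fin d) → EuclideanSpace ℝ (Fin k)) : ℝ :=
  Real.sqrt (supConst (Fin d) (EuclideanSpace ℝ (Fin k)) *
    (eConst hS hm * Real.exp (eRate hS hm * T) * wordEnergy m u₀))

/-- `0 ≤ R(u₀, T)`. [folklore] -/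
theorem Rdat_nonneg (T : ℝ) (u₀ : EuclideanSpace ℝ (Fin d) → EuclideanSpace ℝ (Fin k)) :
    0 ≤ Rdat hS hm T u₀ := Real.sqrt_nonneg _

include hsm in
/-- `R(u₀, T) ≤ C_sob^{1/2}` under the smallness condition. [folklore] -/
theorem Rdat_le_sqrt_supConst : Rdat hS hm T u₀ ≤ Real.sqrt (supConst (Fin d) (EuclideanSpace ℝ (Fin k))) := by
  unfold Rdat
  exact Real.sqrt_le_sqrt (mul_le_of_le_one_right supConst_nonneg hsm.le)

include hT hsm in
/-- **Uniform sup bounds**: `‖∂_c W_δ(t)(x)‖ ≤ R(u₀, T)` for `|c| + 2(d+1) ≤ m`, `δ ∈ (0, 1]`,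
`|t| ≤ T`. [cite: Majda1984, Ch. 2 §2.1, Thm 2.1 (proof, Step 3)] -/
theorem norm_cwd_Wfam_le_Rdat {δ : ℝ} (hδ : 0 < δ) (hδ1 : δ ≤ 1) {t : ℝ} (ht : t ∈ Icc (-T) T)
    (c : List (Fin d)) (hc : c.length + 2 * (d + 1) ≤ m) (x : EuclideanSpace ℝ (Fin d)) :
    ‖cwd c (Wfam hS.toIsTameCoeff hu₀ hu₀c δ t) x‖ ≤ Rdat hS hm T u₀ := by
  rw [Wfam_eq _ hu₀ hu₀c hδ]
  refine (norm_cwd_smoothRep_flow_le_sqrt hS.toIsTameCoeff hδ hu₀ hu₀c (flow_zero _ hδ hu₀ hu₀c)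
    (hasDerivAt_flow _ hδ hu₀ hu₀c) c hc t x).trans ?_
  unfold Rdat
  exact Real.sqrt_le_sqrt (mul_le_mul_of_nonneg_left (energy_Wfam_le hS hm hu₀ hu₀c hT hsm hδ hδ1 ht)
    supConst_nonneg)

include hT hsm in
/-- **`L²` bounds**: `‖∂_c W_δ(t)‖₂ ≤ 1` for `|c| ≤ m`. [folklore] -/
theorem l2norm_cwd_Wfam_le_one {δ : ℝ} (hδ : 0 < δ) (hδ1 : δ ≤ 1) {t : ℝ} (ht : t ∈ Icc (-T) T)
    (c : List (Fin d)) (hc : c.length ≤ m) :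
    MemLp (cwd c (Wfam hS.toIsTameCoeff hu₀ hu₀c δ t)) 2 (volume : Measure (EuclideanSpace ℝ (Fin d))) ∧
      l2norm (cwd c (Wfam hS.toIsTameCoeff hu₀ hu₀c δ t)) ≤ 1 := by
  rw [Wfam_eq _ hu₀ hu₀c hδ]
  have h := l2norm_cwd_smoothRep_flow_le_sqrt hS.toIsTameCoeff hδ hu₀ hu₀c (flow_zero _ hδ hu₀ hu₀c)
    (hasDerivAt_flow _ hδ hu₀ hu₀c) c hc t
  exact ⟨h.1, h.2.trans ((Real.sqrt_le_sqrt (energy_Wfam_le_one hS hm hu₀ hu₀c hT hsm hδ hδ1 ht)).trans_eq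
    Real.sqrt_one)⟩

/-- Every word derivative of every slice is in `L²` (no smallness needed). [folklore] -/
theorem memLp_cwd_Wfam {δ : ℝ} (hδ : 0 < δ) (t : ℝ) (c : List (Fin d)) :
    MemLp (cwd c (Wfam hS.toIsTameCoeff hu₀ hu₀c δ t)) 2 (volume : Measure (EuclideanSpace ℝ (Fin d))) := by
  rw [Wfam_eq _ hu₀ hu₀c hδ]
  exact (memLp_cwd_smoothRep (contDiff_moll hδ) (hasCompactSupport_moll hδ) _ c).1

/-- Every word derivative of every slice is bounded (no smallness needed). [folklore] -/
theorem exists_bound_cwd_Wfam {δ : ℝ} (hδ : 0 < δ) (t : ℝ) (c : List (Fin d)) :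
    ∃ C : ℝ, ∀ x, ‖cwd c (Wfam hS.toIsTameCoeff hu₀ hu₀c δ t) x‖ ≤ C := by
  rw [Wfam_eq _ hu₀ hu₀c hδ]
  exact ⟨_, fun x => norm_cwd_smoothRep_le (contDiff_moll hδ) (hasCompactSupport_moll hδ) _ c x⟩

include hT hsm in
/-- **The `L²`-Cauchy bound for the family**: for `δ, δ' ∈ (0, 1]` and `|t| ≤ T`,
`‖W_δ(t) - W_{δ'}(t)‖₂ ≤ cConst e^{cRate T} (δ + δ')(1 + Σⱼ‖∂ⱼu₀‖₂)`.
[cite: Majda1984, Ch. 2 §2.1, Thm 2.1 (proof, Step 2)] -/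
theorem l2norm_Wfam_sub_le {δ δ' : ℝ} (hδ : 0 < δ) (hδ1 : δ ≤ 1) (hδ' : 0 < δ') (hδ'1 : δ' ≤ 1)
    {t : ℝ} (ht : t ∈ Icc (-T) T) :
    l2norm (fun x => Wfam hS.toIsTameCoeff hu₀ hu₀c δ t x - Wfam hS.toIsTameCoeff hu₀ hu₀c δ' t x) ≤
      cConst hS hm * Real.exp (cRate hS hm * T) * (δ + δ') * (1 + ∑ j, l2norm (cwd [j] u₀)) := by
  rw [Wfam_eq _ hu₀ hu₀c hδ, Wfam_eq _ hu₀ hu₀c hδ']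
  refine (cauchy_of_energy_le_one hS hm u₀ hδ hδ' hu₀ hu₀c (flow_zero _ hδ hu₀ hu₀c)
    (flow_zero _ hδ' hu₀ hu₀c) (hasDerivAt_flow _ hδ hu₀ hu₀c) (hasDerivAt_flow _ hδ' hu₀ hu₀c) T
    (fun τ hτ => energy_Wfam_le_one hS hm hu₀ hu₀c hT hsm hδ hδ1 hτ)
    (fun τ hτ => energy_Wfam_le_one hS hm hu₀ hu₀c hT hsm hδ' hδ'1 hτ) ht).trans ?_
  have habs : |t| ≤ T := abs_le.2 ⟨by linarith [ht.1], ht.2⟩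
  have hexp : Real.exp (cRate hS hm * |t|) ≤ Real.exp (cRate hS hm * T) :=
    Real.exp_le_exp.2 (mul_le_mul_of_nonneg_left habs (cRate_nonneg hS hm))
  have hD0 : 0 ≤ 1 + ∑ j, l2norm (cwd [j] u₀) :=
    add_nonneg zero_le_one (Finset.sum_nonneg fun j _ => l2norm_nonneg _)
  have h1 : cConst hS hm * Real.exp (cRate hS hm * |t|) ≤ cConst hS hm * Real.exp (cRate hS hm * T) :=
    mul_le_mul_of_nonneg_left hexp (cConst_nonneg hS hm)
  exact mul_le_mul_of_nonneg_right (mul_le_mul_of_nonneg_right h1 (by positivity)) hD0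

end Family

end Literature.Barriers.AtomisticToContinuum

end
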